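import Summits.Ventures.LatticeQCDFlow.TrivializingMaps.WilsonVarianceExtensive
import Summits.Ventures.LatticeQCDFlow.Exactness.SU2A0Moments

/-!
HONEST FRAMING: exact (Metropolis-corrected) sampling algorithms for lattice gauge theory; figures
of merit are autocorrelation/cost numbers at stated couplings and volumes; no continuum-physics
claim.

# WilsonSU2FisherZeroRadius — the EXPLICIT number for `SU(2)`: `m₂(2) = 1`, so every finite-volume
# `SU(2)` Wilson partition function (`d ≥ 2`, `L ≥ 2`) has a Fisher zero with `|s| < 1280`, and
# Lüscher's volume-uniform radius for `SU(2)` is `≤ 1280` (lean-2 GEN-6, ours)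

Venture-side (OURS).  Cell `lqcd-flow` (pub-lqcd), unit `pub-lqcd-lean-2-g6`, 2026-08-22.
`WilsonVarianceExtensive` proved, for `SU(n)`, a Fisher zero of every `Z_{d,L,n}` inside the disc of
radius `R₀(n) = max 1 (256(2n+1)/m₂(n))` with `m₂(n) = ∫_{SU(n)} (Re tr)² dHaar` left unevaluated.
For `n = 2` the tree already knows the Haar moments of `a₀ = Re tr U / 2`
(`Exactness.su2Moment_zero_two : ⟨a₀²⟩ = 1/4`, the semicircle law of the SU(2) heat bath, row 9), so
`m₂(2) = 4 · ¼ = 1` (`haarSqReTrace_su2`), `Var_{D[U]}(S_W) = #plaquettes` exactly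
(`wilson_su2_variance_eq`), and `R₀(2) = 256 · 5 = 1280`:

* **`wilson_su2_exists_fisherZero_norm_lt`** — for every `d ≥ 2` and every `L ≥ 2` the `SU(2)`
  Wilson partition function `Z_L(s) = ∫ D[U] e^{-s S_W}` (`S_W = ∑_p Re tr(1 - U_p)`) has a zero with
  `|s₀| < 1280`;
* **`wilson_su2_theoremA_radius_le`** — every radius `ρ` of a THEOREM-A-type volume-uniform
  geometric gradient bound for the `SU(2)` Wilson action satisfies `ρ ≤ 1280`.

In the conventional normalisation `β·∑_p(1 − ½ Re tr U_p)` the coupling is `β = 2s`, so the disc is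
`|β| < 2560`.  NOT CLAIMED: that this is anywhere near sharp (printed MCMC-located zeros of `Z_4`
sit at `|s| ≈ 1`); `L = 1`; `n ≥ 3` (needs `m₂(n) = ½`, Schur orthogonality, not in the tree);
cost / autocorrelation / continuum statements.
-/

open MeasureTheory ProbabilityTheory Filter Topology Complex Set Metric
open Literature.MathematicalPhysics.QuantumFieldTheory
open Literature.MathematicalPhysics.QuantumFieldTheory.Luscher2010
open Literature.MathematicalPhysics.QuantumFieldTheory.WilsonFlow (coeConfig continuous_coeConfig)
open scoped Matrix Matrix.Norms.Frobenius ContDiff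

namespace Summit.Ventures.LatticeQCDFlow.TrivializingMaps

/-- **`m₂(2) = ∫_{SU(2)} (Re tr g)² dg = 1`** (`= 4⟨a₀²⟩ = 4 · ¼`, tree `Exactness.su2Moment_zero_two`).
[ours] -/
theorem haarSqReTrace_su2 :
    ∫ g, ((g : Matrix (Fin 2) (Fin 2) ℂ)).trace.re ^ 2
      ∂(haarProbability (Matrix.specialUnitaryGroup (Fin 2) ℂ)) = 1 := by
  have h := Exactness.su2Moment_zero_two
  unfold Exactness.su2Moment at h
  simp only [zero_mul, Real.exp_zero, mul_one] at h
  have hfun : (fun g : Matrix.specialUnitaryGroup (Fin 2) ℂ =>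
      ((g : Matrix (Fin 2) (Fin 2) ℂ)).trace.re ^ 2) =
      fun g => 4 * Exactness.su2a0 g ^ 2 := by
    funext g
    simp only [Exactness.su2a0]
    ring
  rw [hfun, integral_const_mul, h]
  norm_num

variable {d L : ℕ} [NeZero L]

/-- **`Var_{D[U]}(S_W ∘ ι) = #plaquettes`** for `SU(2)`, `L ≥ 2`. [ours] -/
theorem wilson_su2_variance_eq (hL : 2 ≤ L) :
    variance (fun U => ambWilsonAction (coeConfig U))
        (trivialMeasure (Matrix.specialUnitaryGroup (Fin 2) ℂ) d L) =
      Fintype.card (Plaquette d L) := by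
  rw [wilson_variance_eq hL le_rfl, haarSqReTrace_su2, one_mul]

/-- **Every finite-volume `SU(2)` Wilson partition function has a Fisher zero with `|s₀| < 1280`**
(`d ≥ 2`, every `L ≥ 2`). [ours] -/
theorem wilson_su2_exists_fisherZero_norm_lt (hd : 2 ≤ d) (hL : 2 ≤ L) :
    ∃ s₀ : ℂ, ‖s₀‖ < 1280 ∧
      complexMGF (fun U => -ambWilsonAction (coeConfig U))
        (trivialMeasure (Matrix.specialUnitaryGroup (Fin 2) ℂ) d L) s₀ = 0 := by
  obtain ⟨s₀, hs₀, hz⟩ :=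
    wilson_exists_fisherZero_norm_lt_uniform (d := d) (L := L) (n := 2) hd le_rfl hL
  refine ⟨s₀, ?_, hz⟩
  rw [haarSqReTrace_su2] at hs₀
  have : max (1 : ℝ) (256 * (2 * (2 : ℕ) + 1) / 1) = 1280 := by norm_num
  rwa [this] at hs₀

/-- **Lüscher's volume-uniform radius for `SU(2)` is at most `1280`**: every `ρ > 0` admitting a
volume-uniform geometric gradient bound `|∂^a_e S̃^{(k)}| ≤ C ρ^{-k}` for the Lüscher series of the
`SU(2)` Wilson action (`d ≥ 2`) satisfies `ρ ≤ 1280`. [ours] -/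
theorem wilson_su2_theoremA_radius_le (hd : 2 ≤ d) {ρ C : ℝ} (hρ : 0 < ρ)
    (hA : ∀ (L : ℕ) [NeZero L] (B : SuBasis 2) (Sk : ℕ → AmbConfig d L 2 → ℝ) (c : ℕ → ℝ),
      (∀ k, ContDiff ℝ ∞ (Sk k)) → IsLuscherSeries B ambWilsonAction Sk c →
      ∀ (k : ℕ) (U : GaugeConfig d L (Matrix.specialUnitaryGroup (Fin 2) ℂ)) (e : Edge d L)
        (a : B.ι), |linkDeriv e (B.T a) (Sk k) (coeConfig U)| ≤ C * ρ⁻¹ ^ k)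
    (B : SuBasis 2) : ρ ≤ 1280 := by
  have h := wilson_theoremA_radius_le_uniform (d := d) (n := 2) hd le_rfl hρ hA B
  rw [haarSqReTrace_su2] at h
  have : max (1 : ℝ) (256 * (2 * (2 : ℕ) + 1) / 1) = 1280 := by norm_num
  rwa [this] at h

end Summit.Ventures.LatticeQCDFlow.TrivializingMaps
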